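import Mathlib
import HarnessLib
import Literature.Combinatorics.Additive.Pollard
import Literature.Combinatorics.Additive.Kneser
import Literature.Combinatorics.Additive.GrynkiewiczPollardRep

/-!
# Grynkiewicz's extension of Pollard's theorem — port, part II: stabilizer cosets and the Kneser tools

Topic: `Literature/Combinatorics/Additive`.  Second file of the port of [Gry10] Theorem 1.1 / 1.2.  The
stabilizer `H = S.addStab` of a nonempty finset (tree `Finset.addStab`, `Kneser.lean`) is a finite subgroup;
this file collects the coset calculus the proof uses (symmetry, cosets `a +ᵥ H`, `H`-holes
`ρ_A = |A + H| − |A|`, "every coset meeting `A` has at least `|H| − ρ_A` points of `A`", the coset lower bound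
`r_{A,B}(a + b) ≥ |A ∩ (a+H)| + |B ∩ (b+H)| − |H|`) and the three consequences of Kneser's theorem used in
[Gry10] §2: the equality case ("Kneser-tight": `|A + B| < |A| + |B| ⇒ |A + B| = |A + H| + |B + H| − |H|`),
Proposition 5 (i) (`|A + B| ≤ |A| + |B| − k ⇒` every sum has `≥ k` representations) and Lemma 2.2 in the
form the proof applies it (for a Kneser-tight pair `A′, B′` and `a ∉ A′ + H` some `a + b′`, `b′ ∈ B′`, lies
outside `A′ + B′`).

## References
* D. J. Grynkiewicz, *On extending Pollard's theorem for t-representable sums*, Israel J. Math. 177 (2010)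
  413–439 (arXiv:0803.2601), §2: Proposition 5, Lemma 2.2 [cite: Grynkiewicz2010, Lemma 2.2].
* M. B. Nathanson, GTM 165 (1996), §4.1–4.2 (stabilizers, Kneser) [cite: Nathanson1996, §4.1].
-/

namespace Literature.Combinatorics.Additive

namespace Grynkiewicz

open Finset Pollard
open scoped Pointwise

variable {G : Type*} [AddCommGroup G] [DecidableEq G]

/-! ### The stabilizer of a nonempty finset is a finite subgroup: coset calculus -/

section Stab

variable {S : Finset G}

/-- `0 ∈ H`. [cite: Nathanson1996, §4.1] -/
theorem zero_mem_addStab' (hS : S.Nonempty) : (0 : G) ∈ S.addStab := zero_mem_addStab.2 hS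

/-- `H` is closed under addition. [cite: Nathanson1996, §4.1] -/
theorem add_mem_addStab {h₁ h₂ : G} (h1 : h₁ ∈ S.addStab) (h2 : h₂ ∈ S.addStab) : h₁ + h₂ ∈ S.addStab := by
  have : h₁ + h₂ ∈ S.addStab + S.addStab := add_mem_add h1 h2
  rwa [addStab_add_addStab] at this

/-- `H` is closed under negation. [cite: Nathanson1996, §4.1] -/
theorem neg_mem_addStab {h : G} (hh : h ∈ S.addStab) : -h ∈ S.addStab := by
  have hS : S.Nonempty := Nonempty.of_addStab ⟨h, hh⟩
  rw [mem_addStab hS] at hh ⊢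
  conv_lhs => rw [← hh]
  rw [vadd_vadd, neg_add_cancel, zero_vadd]

/-- `H` is closed under subtraction. [cite: Nathanson1996, §4.1] -/
theorem sub_mem_addStab {h₁ h₂ : G} (h1 : h₁ ∈ S.addStab) (h2 : h₂ ∈ S.addStab) : h₁ - h₂ ∈ S.addStab := by
  rw [sub_eq_add_neg]; exact add_mem_addStab h1 (neg_mem_addStab h2)

/-- `H = -H`. [cite: Nathanson1996, §4.1] -/
theorem neg_addStab (S : Finset G) : -S.addStab = S.addStab := by
  ext h
  rw [mem_neg']
  exact ⟨fun hh => by simpa using neg_mem_addStab hh, fun hh => neg_mem_addStab hh⟩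

/-- Membership in a coset: `b ∈ a + H ↔ b - a ∈ H`. [cite: Nathanson1996, §4.1] -/
theorem mem_coset_iff {a b : G} : b ∈ a +ᵥ S.addStab ↔ b - a ∈ S.addStab := by
  rw [mem_vadd_finset]
  constructor
  · rintro ⟨h, hh, rfl⟩; simpa using hh
  · intro hb; exact ⟨b - a, hb, by simp [vadd_eq_add]⟩

/-- `a ∈ a + H`. [cite: Nathanson1996, §4.1] -/
theorem mem_coset_self (hS : S.Nonempty) (a : G) : a ∈ a +ᵥ S.addStab :=
  mem_coset_iff.2 (by rw [sub_self]; exact zero_mem_addStab' hS)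

/-- Two cosets sharing an element's coset coincide: `b ∈ a + H → b + H = a + H`. [cite: Nathanson1996, §4.1] -/
theorem coset_eq_of_mem {a b : G} (hb : b ∈ a +ᵥ S.addStab) : b +ᵥ S.addStab = a +ᵥ S.addStab := by
  rw [mem_coset_iff] at hb
  have : b = a + (b - a) := by abel
  rw [this, ← vadd_vadd, vadd_addStab hb]

/-- Two cosets are equal or disjoint. [cite: Nathanson1996, §4.1] -/
theorem coset_eq_or_disjoint (a b : G) :
    a +ᵥ S.addStab = b +ᵥ S.addStab ∨ Disjoint (a +ᵥ S.addStab) (b +ᵥ S.addStab) := by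
  by_cases h : Disjoint (a +ᵥ S.addStab) (b +ᵥ S.addStab)
  · exact Or.inr h
  · left
    obtain ⟨c, hca, hcb⟩ := not_disjoint_iff.1 h
    rw [← coset_eq_of_mem hca, coset_eq_of_mem hcb]

/-- `|a + H| = |H|`. [cite: Nathanson1996, §4.1] -/
theorem card_coset (a : G) : (a +ᵥ S.addStab).card = S.addStab.card := card_vadd_finset a _

/-- A coset of an element of `A` lies in `A + H`. [cite: Nathanson1996, §4.1] -/
theorem coset_subset_add {A : Finset G} {a : G} (ha : a ∈ A) : a +ᵥ S.addStab ⊆ A + S.addStab :=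
  vadd_finset_subset_add ha

/-- `A ⊆ A + H`. [cite: Nathanson1996, §4.1] -/
theorem subset_add_addStab (hS : S.Nonempty) (A : Finset G) : A ⊆ A + S.addStab := fun a ha =>
  mem_add.2 ⟨a, ha, 0, zero_mem_addStab' hS, add_zero a⟩

/-- `(A + H) + H = A + H`. [cite: Nathanson1996, §4.1] -/
theorem add_addStab_add_addStab (A : Finset G) : A + S.addStab + S.addStab = A + S.addStab := by
  rw [add_assoc, addStab_add_addStab]

/-- `(a + H) + H = a + H`. [cite: Nathanson1996, §4.1] -/
theorem coset_add_addStab (a : G) : (a +ᵥ S.addStab) + S.addStab = a +ᵥ S.addStab := by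
  apply Subset.antisymm
  · intro x hx
    obtain ⟨u, hu, h₂, hh₂, rfl⟩ := mem_add.1 hx
    obtain ⟨h₁, hh₁, rfl⟩ := mem_vadd_finset.1 hu
    exact mem_vadd_finset.2 ⟨h₁ + h₂, add_mem_addStab hh₁ hh₂, by simp only [vadd_eq_add]; abel⟩
  · intro x hx
    obtain ⟨h₁, hh₁, rfl⟩ := mem_vadd_finset.1 hx
    have hS : S.Nonempty := Nonempty.of_addStab ⟨h₁, hh₁⟩
    exact mem_add.2 ⟨a +ᵥ h₁, hx, 0, zero_mem_addStab' hS, add_zero _⟩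

/-- An `H`-periodic set contains the coset of each of its points. [cite: Nathanson1996, §4.1] -/
theorem coset_subset_of_periodic {P : Finset G} (hP : P + S.addStab = P) {p : G} (hp : p ∈ P) :
    p +ᵥ S.addStab ⊆ P := by
  rw [← hP]; exact coset_subset_add hp

/-- Membership in an `H`-periodic set is coset-invariant. [cite: Nathanson1996, §4.1] -/
theorem mem_of_periodic_of_sub_mem {P : Finset G} (hP : P + S.addStab = P) {p q : G} (hp : p ∈ P)
    (hq : q - p ∈ S.addStab) : q ∈ P :=
  coset_subset_of_periodic hP hp (mem_coset_iff.2 hq)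

/-- `A + H` is `H`-periodic and `S` itself is `S.addStab`-periodic. [cite: Nathanson1996, §4.1] -/
theorem add_addStab_self (S : Finset G) : S + S.addStab = S := add_addStab S

/-! ### Holes -/

/-- The number of `H`-holes of `A`: `ρ_A = |A + H| − |A|`. [cite: Grynkiewicz2010, §1] -/
theorem card_le_card_add_addStab (hS : S.Nonempty) (A : Finset G) : A.card ≤ (A + S.addStab).card :=
  card_le_card (subset_add_addStab hS A)

/-- Every coset meeting `A` contains at least `|H| − ρ_A` points of `A`:
`|H| ≤ |A ∩ (a + H)| + (|A + H| − |A|)` for `a ∈ A`. [cite: Grynkiewicz2010, §2 Step 1] -/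
theorem card_addStab_le_card_inter_coset_add_holes (hS : S.Nonempty) {A : Finset G} {a : G} (ha : a ∈ A) :
    S.addStab.card ≤ (A ∩ (a +ᵥ S.addStab)).card + ((A + S.addStab).card - A.card) := by
  have h1 : (a +ᵥ S.addStab).card = (A ∩ (a +ᵥ S.addStab)).card + ((a +ᵥ S.addStab) \ A).card := by
    rw [inter_comm, card_inter_add_card_sdiff]
  have h2 : ((a +ᵥ S.addStab) \ A).card ≤ (A + S.addStab).card - A.card := by
    rw [← card_sdiff_of_subset (subset_add_addStab hS A)]
    exact card_le_card (sdiff_subset_sdiff (coset_subset_add ha) (Subset.refl A))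
  rw [← card_coset a, h1]
  omega

/-- The same bound for a coset given by any of its points: if `b ∈ a + H` and the coset meets `A`, then
`|H| ≤ |A ∩ (a + H)| + ρ_A`. [cite: Grynkiewicz2010, §2 Step 1] -/
theorem card_addStab_le_card_inter_coset_add_holes' (hS : S.Nonempty) {A : Finset G} {a b : G} (hb : b ∈ A)
    (hba : b ∈ a +ᵥ S.addStab) :
    S.addStab.card ≤ (A ∩ (a +ᵥ S.addStab)).card + ((A + S.addStab).card - A.card) := by
  rw [← coset_eq_of_mem hba]; exact card_addStab_le_card_inter_coset_add_holes hS hb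

/-! ### The coset lower bound for the representation function -/

/-- For a finite subgroup `H = S.addStab`: `r_{A,B}(a + b) + |H| ≥ |A ∩ (a + H)| + |B ∩ (b + H)|`
(the representations `(a + h) + (b − h)`, `h ∈ H`). [cite: Grynkiewicz2010, §2 Step 1] -/
theorem card_inter_coset_add_le_rep_add (A B : Finset G) (a b : G) :
    (A ∩ (a +ᵥ S.addStab)).card + (B ∩ (b +ᵥ S.addStab)).card ≤ rep A B (a + b) + S.addStab.card := by
  -- `HA = {h ∈ H : a + h ∈ A}`, `HB = {h ∈ H : b - h ∈ B}`
  set HA := S.addStab.filter (fun h => a + h ∈ A) with hHA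
  set HB := S.addStab.filter (fun h => b - h ∈ B) with hHB
  have hcA : (A ∩ (a +ᵥ S.addStab)).card = HA.card := by
    refine card_nbij' (fun x => x - a) (fun h => a + h) ?_ ?_ ?_ ?_
    · intro x hx
      rw [mem_coe, mem_inter, mem_coset_iff] at hx
      rw [mem_coe, hHA, mem_filter]
      exact ⟨hx.2, by rw [add_sub_cancel]; exact hx.1⟩
    · intro h hh
      rw [mem_coe, hHA, mem_filter] at hh
      rw [mem_coe, mem_inter, mem_coset_iff]
      exact ⟨hh.2, by rw [add_sub_cancel_left]; exact hh.1⟩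
    · intro x _; simp
    · intro h _; simp
  have hcB : (B ∩ (b +ᵥ S.addStab)).card = HB.card := by
    refine card_nbij' (fun x => b - x) (fun h => b - h) ?_ ?_ ?_ ?_
    · intro x hx
      rw [mem_coe, mem_inter, mem_coset_iff] at hx
      rw [mem_coe, hHB, mem_filter]
      refine ⟨?_, by rw [sub_sub_cancel]; exact hx.1⟩
      have := neg_mem_addStab hx.2
      rwa [neg_sub] at this
    · intro h hh
      rw [mem_coe, hHB, mem_filter] at hh
      rw [mem_coe, mem_inter, mem_coset_iff]
      refine ⟨hh.2, ?_⟩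
      have := neg_mem_addStab hh.1
      rwa [show b - h - b = -h by abel]
    · intro x _; simp
    · intro h _; simp
  have hAB : (HA ∩ HB).card ≤ rep A B (a + b) := by
    rw [rep_eq_card_filter_left]
    have hinj : Set.InjOn (fun h => a + h) ↑(HA ∩ HB) := fun h _ h' _ (e : a + h = a + h') => add_left_cancel e
    rw [← card_image_of_injOn hinj]
    refine card_le_card fun x hx => ?_
    obtain ⟨h, hh, rfl⟩ := mem_image.1 hx
    rw [mem_inter, hHA, hHB, mem_filter, mem_filter] at hh
    rw [mem_filter]
    exact ⟨hh.1.2, by rw [show a + b - (a + h) = b - h by abel]; exact hh.2.2⟩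
  have hU : (HA ∪ HB).card ≤ S.addStab.card :=
    card_le_card (union_subset (filter_subset _ _) (filter_subset _ _))
  have := card_union_add_card_inter HA HB
  rw [hcA, hcB]
  omega

/-! ### Kneser's theorem: the equality case, Proposition 5 (i), Lemma 2.2 -/

/-- **Kneser, equality case.** If `|A + B| < |A| + |B|` then, with `H` the stabilizer of `A + B`,
`|A + B| + |H| = |A + H| + |B + H|`. [cite: Nathanson1996, Thm 4.2] -/
theorem kneser_eq_of_card_add_lt {A B : Finset G} (hA : A.Nonempty) (hB : B.Nonempty)
    (h : (A + B).card < A.card + B.card) :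
    (A + B).card + (A + B).addStab.card = (A + (A + B).addStab).card + (B + (A + B).addStab).card := by
  have hk := add_kneser A B
  have hH : (A + B).addStab.Nonempty := (hA.add hB).addStab
  rcases hk.lt_or_eq with hlt | heq
  · have h2 := add_strict_kneser A B hlt
    have hA' : A.card ≤ (A + (A + B).addStab).card := card_le_card_add_right hH
    have hB' : B.card ≤ (B + (A + B).addStab).card := card_le_card_add_right hH
    omega
  · exact heq.symm

/-- **Kneser, nontrivial stabilizer.** If `|A + B| + 2 ≤ |A| + |B|` then the stabilizer of `A + B` has at least
two elements. [cite: Nathanson1996, Thm 4.2] -/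
theorem one_lt_card_addStab_of_card_add_le {A B : Finset G} (hA : A.Nonempty) (hB : B.Nonempty)
    (h : (A + B).card + 2 ≤ A.card + B.card) : 1 < (A + B).addStab.card := by
  have hH : (A + B).addStab.Nonempty := (hA.add hB).addStab
  have := card_add_card_le_card_add_add_card_addStab A B hA hB
  omega

/-- **[Gry10] Proposition 5 (i).** If `|A + B| + k ≤ |A| + |B|` then every element of `A + B` has at least
`k` representations. [cite: Grynkiewicz2010, Prop 5] -/
theorem le_rep_of_card_add_le {A B : Finset G} {k : ℕ} (h : (A + B).card + k ≤ A.card + B.card)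
    {w : G} (hw : w ∈ A + B) : k ≤ rep A B w := by
  obtain ⟨a, ha, b, hb, rfl⟩ := mem_add.1 hw
  have hA : A.Nonempty := ⟨a, ha⟩
  have hB : B.Nonempty := ⟨b, hb⟩
  set S := A + B with hSdef
  have hS : S.Nonempty := hA.add hB
  have hk := add_kneser A B
  rw [← hSdef] at hk
  have h1 := card_addStab_le_card_inter_coset_add_holes hS ha (S := S)
  have h2 := card_addStab_le_card_inter_coset_add_holes hS hb (S := S)
  have h3 := card_inter_coset_add_le_rep_add A B a b (S := S)
  have h4 := card_le_card_add_addStab hS A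
  have h5 := card_le_card_add_addStab hS B
  omega

/-- **[Gry10] Lemma 2.2, applied form.** Let `A′, B′` be nonempty, `H` the stabilizer of `A′ + B′`, and suppose
the pair is Kneser-tight: `|A′ + B′| + |H| = |A′ + H| + |B′ + H|`.  If `a ∉ A′ + H` then some `a + b′`
(`b′ ∈ B′`) lies outside `A′ + B′` (else Kneser's theorem for `(A′ + H) ∪ (a + H)` and `B′ + H` fails).
[cite: Grynkiewicz2010, Lemma 2.2] -/
theorem exists_add_not_mem_of_not_mem_add_addStab {A' B' : Finset G} (hA : A'.Nonempty) (hB : B'.Nonempty)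
    (htight : (A' + B').card + (A' + B').addStab.card =
      (A' + (A' + B').addStab).card + (B' + (A' + B').addStab).card)
    {a : G} (ha : a ∉ A' + (A' + B').addStab) : ∃ b' ∈ B', a + b' ∉ A' + B' := by
  by_contra hcon
  simp only [not_exists, not_and, not_not] at hcon
  set H := (A' + B').addStab with hH
  have hSne : (A' + B').Nonempty := hA.add hB
  have hHne : H.Nonempty := hSne.addStab
  have hper : A' + B' + H = A' + B' := add_addStab _
  -- the enlarged pair
  set As := (A' + H) ∪ (a +ᵥ H) with hAs
  set Bs := B' + H with hBs
  have hsum : As + Bs = A' + B' := by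
    apply Subset.antisymm
    · intro w hw
      obtain ⟨u, hu, v, hv, rfl⟩ := mem_add.1 hw
      rw [hBs] at hv
      obtain ⟨b', hb', h2, hh2, rfl⟩ := mem_add.1 hv
      rcases mem_union.1 hu with hu1 | hu2
      · obtain ⟨a', ha', h1, hh1, rfl⟩ := mem_add.1 hu1
        have : a' + h1 + (b' + h2) = (a' + b') + (h1 + h2) := by abel
        rw [this, ← hper]
        exact add_mem_add (add_mem_add ha' hb') (add_mem_addStab hh1 hh2)
      · obtain ⟨h1, hh1, rfl⟩ := mem_vadd_finset.1 hu2
        have : (a +ᵥ h1) + (b' + h2) = (a + b') + (h1 + h2) := by rw [vadd_eq_add]; abel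
        rw [this, ← hper]
        exact add_mem_add (hcon b' hb') (add_mem_addStab hh1 hh2)
    · intro w hw
      obtain ⟨a', ha', b', hb', rfl⟩ := mem_add.1 hw
      exact mem_add.2 ⟨a', mem_union_left _ (subset_add_addStab hSne A' ha'), b',
        subset_add_addStab hSne B' hb', rfl⟩
  -- its Kneser inequality
  have hk := add_kneser As Bs
  rw [hsum] at hk
  -- `As`, `Bs` are `H`-periodic
  have hAsH : As + H = As := by
    rw [hAs, union_add, add_addStab_add_addStab, ← hH, coset_add_addStab]
  have hBsH : Bs + H = Bs := by rw [hBs, add_addStab_add_addStab]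
  rw [← hH, hAsH, hBsH] at hk
  -- `|As| = |A' + H| + |H|`
  have hdisj : Disjoint (A' + H) (a +ᵥ H) := by
    rw [disjoint_right]
    rintro x hx hx'
    rw [mem_coset_iff, ← hH] at hx
    apply ha
    have e : a = x + -(x - a) := by abel
    rw [e, ← add_addStab_add_addStab A']
    exact add_mem_add hx' (neg_mem_addStab hx)
  have hcard : As.card = (A' + H).card + H.card := by
    rw [hAs, card_union_of_disjoint hdisj, card_coset]
  rw [hcard] at hk
  have := hHne.card_pos
  omega

/-! ### Stabilizer facts -/

/-- If `y + T ⊆ T` (finite `T` nonempty) then `y` stabilizes `T`. [cite: Nathanson1996, §4.1] -/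
theorem mem_addStab_of_vadd_subset {T : Finset G} (hT : T.Nonempty) {y : G} (h : y +ᵥ T ⊆ T) : y ∈ T.addStab :=
  (mem_addStab_iff_vadd_finset_subset hT).2 h

/-- If `y + T ⊆ T` pointwise then `y` stabilizes `T`. [cite: Nathanson1996, §4.1] -/
theorem mem_addStab_of_forall_add_mem {T : Finset G} (hT : T.Nonempty) {y : G} (h : ∀ z ∈ T, y + z ∈ T) :
    y ∈ T.addStab :=
  mem_addStab_of_vadd_subset hT fun w hw => by
    obtain ⟨z, hz, rfl⟩ := mem_vadd_finset.1 hw; exact h z hz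

/-- The stabilizer of a finset is at most as large as the finset. [cite: Nathanson1996, §4.1] -/
theorem card_addStab_le_card' (T : Finset G) : T.addStab.card ≤ T.card := card_addStab_le_card

/-- `stab(T) ⊆ stab(T + B)`. [cite: Nathanson1996, §4.1] -/
theorem addStab_subset_addStab_add {T B : Finset G} (hB : B.Nonempty) : T.addStab ⊆ (T + B).addStab :=
  subset_addStab_add_left hB

/-- If `B − B ⊆ stab(A)` in the form `∀ b b' ∈ B, b − b' ∈ stab(A)`, then `|B| ≤ |stab(A)|`.
[cite: Grynkiewicz2010, §2 (stab-A-small)] -/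
theorem card_le_card_addStab_of_sub_mem {A B : Finset G} {b₀ : G}
    (h : ∀ b ∈ B, b - b₀ ∈ A.addStab) : B.card ≤ A.addStab.card := by
  have hinj : Set.InjOn (fun b => b - b₀) ↑B := fun b _ b' _ (e : b - b₀ = b' - b₀) => sub_left_injective e
  rw [← card_image_of_injOn hinj]
  exact card_le_card fun x hx => by obtain ⟨b, hb, rfl⟩ := mem_image.1 hx; exact h b hb

end Stab

end Grynkiewicz

end Literature.Combinatorics.Additive
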